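import Summits.QuantumFields.YangMills.Theorems.ColdStartUniversalityLatticeLangevinGradientDriftFlat
import HarnessLib

/-!
# Route `ColdStartUniversality`, crux K_A1 `UniformColdStartMixing` (stmt-QuantumFields-24809), rung `stub_fixedCutoffMixing`:
# G-block, brick G1b (flat coordinates, part 2) — SZZ Lemma 3.1 as the gradient hypothesis of the ground-state identity

Helper file (seat `ym-line-csu-p1`, g7).  In the real link coordinates of `dynkin_expectation_szz` the `β`-part of the SU(2) SZZ
drift is half the diffusion matrix applied to the coordinate gradient of the plaquette function
`ψ̂(y) = β Σ_p Re tr(rootedLoop (rebuild y) p false)`: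
`Re/Im((driftLie β Q e) Q_e)_{ij} = ½ Σ_{q'} (Σ_n σ_{q n} σ_{q' n}) ∂_{q'} ψ̂(flat Q)` (`driftLie_mul_entry_eq_half_sum`) — exactly the
hypothesis `hb₁` of `generator_groundState` (brick G1a), for every matrix link configuration `Q`.
No definition, no sorry.  RECORD-rung R3 plumbing; nothing here bears on the mass gap.
-/

set_option autoImplicit false

noncomputable section

namespace Summit.QuantumFields.YangMills.Theorems.ColdStartUniversality

open Finset Matrix Complex
open scoped BigOperators Matrix ComplexConjugate
open Literature.MathematicalPhysics.QuantumFieldTheory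
open Literature.MathematicalPhysics.QuantumLattice (fundamentalRep fundamentalLatticeRep)

/-- `Re/Im` of a finite sum. [folklore] -/
theorem reIm_sum {ι : Type*} (s : Finset ι) (c : Bool) (z : ι → ℂ) :
    (fun w : ℂ => if c then w.im else w.re) (∑ k ∈ s, z k) = ∑ k ∈ s, (fun w : ℂ => if c then w.im else w.re) (z k) := by
  cases c
  · simp [Complex.re_sum]
  · simp [Complex.im_sum]

/-- `Re/Im` of a real multiple. [folklore] -/
theorem reIm_ofReal_mul (c : Bool) (r : ℝ) (z : ℂ) :
    (fun w : ℂ => if c then w.im else w.re) ((r : ℂ) * z) = r * (fun w : ℂ => if c then w.im else w.re) z := by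
  cases c
  · simp [Complex.mul_re]
  · simp [Complex.mul_im]

/-- `Re/Im` of a real multiple, `if`-form. [folklore] -/
theorem ite_im_re_ofReal_mul (c : Bool) (r : ℝ) (z : ℂ) :
    (if c then ((r : ℂ) * z).im else ((r : ℂ) * z).re) = r * (if c then z.im else z.re) := by
  cases c
  · simp [Complex.mul_re]
  · simp [Complex.mul_im]

/-- The noise coefficient as a left multiplication: `σ_{e,n}(Q) = (√2 𝐩E_n) Q_e`, with `√2 𝐩E_n` skew-Hermitian. [folklore] -/
theorem noise_eq_mul {d L : ℕ} (β : ℝ) (Q : MatrixConfig d L (fundamentalLatticeRep 2).N) (e : Edge d L) (n : NoiseIdx (fundamentalLatticeRep 2).N) :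
    (latticeLangevinDynamics (fundamentalLatticeRep 2) β).noise Q e n =
      ((Real.sqrt 2 : ℂ) • (fundamentalLatticeRep 2).lieProj (noiseDir n)) * Q e ∧
    (((Real.sqrt 2 : ℂ) • (fundamentalLatticeRep 2).lieProj (noiseDir n))ᴴ =
      -((Real.sqrt 2 : ℂ) • (fundamentalLatticeRep 2).lieProj (noiseDir n))) := by
  refine ⟨by rw [latticeLangevinDynamics_noise, Matrix.smul_mul], ?_⟩
  rw [Matrix.conjTranspose_smul, Complex.star_def, Complex.conj_ofReal, ← Matrix.star_eq_conjTranspose,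
    (fundamentalLatticeRep 2).star_lieProj, smul_neg]

/-- The coordinate vector `Σ_{q'} σ_{q' n} e_{q'}` of the noise field `n = (e, n₂)` is `flat(δ_e σ_{e,n₂}(Q))`. [folklore] -/
theorem sum_noiseCoord_smul_single {d L : ℕ} [NeZero L] (β : ℝ) (Q : MatrixConfig d L (fundamentalLatticeRep 2).N)
    (n : Edge d L × NoiseIdx (fundamentalLatticeRep 2).N) :
    (∑ q' : Edge d L × Fin (fundamentalLatticeRep 2).N × Fin (fundamentalLatticeRep 2).N × Bool,
      (if n.1 = q'.1 then (fun z : ℂ => if q'.2.2.2 then z.im else z.re)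
        ((latticeLangevinDynamics (fundamentalLatticeRep 2) β).noise Q q'.1 n.2 q'.2.1 q'.2.2.1) else 0) •
        (Pi.single q' (1 : ℝ) : Edge d L × Fin (fundamentalLatticeRep 2).N × Fin (fundamentalLatticeRep 2).N × Bool → ℝ)) =
      fun q : Edge d L × Fin (fundamentalLatticeRep 2).N × Fin (fundamentalLatticeRep 2).N × Bool => (fun z : ℂ => if q.2.2.2 then z.im else z.re)
        ((Pi.single n.1 ((latticeLangevinDynamics (fundamentalLatticeRep 2) β).noise Q n.1 n.2) : MatrixConfig d L (fundamentalLatticeRep 2).N)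
          q.1 q.2.1 q.2.2.1) := by
  classical
  funext q
  rw [Finset.sum_apply]
  simp only [Pi.smul_apply, Pi.single_apply, smul_eq_mul, mul_ite, mul_one, mul_zero]
  rw [Finset.sum_ite_eq]
  simp only [Finset.mem_univ, if_true]
  by_cases h : n.1 = q.1
  · rw [if_pos h, ← h, if_pos rfl]
  · rw [if_neg h, if_neg (Ne.symm h)]
    cases q.2.2.2 <;> simp [Matrix.zero_apply]

/-- **SZZ Lemma 3.1 as the gradient hypothesis `hb₁` of the ground-state identity.**  For every matrix link
configuration `Q` and coordinate index `q = (e, i, j, c)`: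
`Re/Im_c((driftLie β Q e) Q_e)_{ij} = ½ Σ_{q'} (Σ_n σ_{q n}(Q) σ_{q' n}(Q)) ∂_{q'} ψ̂(flat Q)`. [cite: ShenZhuZhu2022, §3 Lemma 3.1] -/
theorem driftLie_mul_entry_eq_half_sum {d L : ℕ} [NeZero L] (β : ℝ) (Q : MatrixConfig d L (fundamentalLatticeRep 2).N)
    (q : Edge d L × Fin (fundamentalLatticeRep 2).N × Fin (fundamentalLatticeRep 2).N × Bool) :
    (fun z : ℂ => if q.2.2.2 then z.im else z.re) (((fundamentalLatticeRep 2).driftLie β Q q.1 * Q q.1) q.2.1 q.2.2.1) =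
      1 / 2 * ∑ q' : Edge d L × Fin (fundamentalLatticeRep 2).N × Fin (fundamentalLatticeRep 2).N × Bool,
        (∑ n : Edge d L × NoiseIdx (fundamentalLatticeRep 2).N,
          (if n.1 = q.1 then (fun z : ℂ => if q.2.2.2 then z.im else z.re)
            ((latticeLangevinDynamics (fundamentalLatticeRep 2) β).noise Q q.1 n.2 q.2.1 q.2.2.1) else 0) *
          (if n.1 = q'.1 then (fun z : ℂ => if q'.2.2.2 then z.im else z.re)
            ((latticeLangevinDynamics (fundamentalLatticeRep 2) β).noise Q q'.1 n.2 q'.2.1 q'.2.2.1) else 0)) *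
        fderiv ℝ (fun y : Edge d L × Fin (fundamentalLatticeRep 2).N × Fin (fundamentalLatticeRep 2).N × Bool → ℝ =>
          β * ∑ p : Plaquette d L, (rootedLoop (fun (e : Edge d L) (i j : Fin (fundamentalLatticeRep 2).N) =>
            ((y (e, i, j, false) : ℝ) : ℂ) + ((y (e, i, j, true) : ℝ) : ℂ) * Complex.I) (p.1, p.2.1.1) p.2.1.2 false).trace.re)
          (fun q'' : Edge d L × Fin (fundamentalLatticeRep 2).N × Fin (fundamentalLatticeRep 2).N × Bool => (fun z : ℂ => if q''.2.2.2 then z.im else z.re)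
            (Q q''.1 q''.2.1 q''.2.2.1))
          (Pi.single q' 1) := by
  classical
  -- abbreviations
  set ψh : (Edge d L × Fin (fundamentalLatticeRep 2).N × Fin (fundamentalLatticeRep 2).N × Bool → ℝ) → ℝ := fun y =>
      β * ∑ p : Plaquette d L, (rootedLoop (fun (e : Edge d L) (i j : Fin (fundamentalLatticeRep 2).N) =>
        ((y (e, i, j, false) : ℝ) : ℂ) + ((y (e, i, j, true) : ℝ) : ℂ) * Complex.I) (p.1, p.2.1.1) p.2.1.2 false).trace.re
    with hψh
  set y₀ : Edge d L × Fin (fundamentalLatticeRep 2).N × Fin (fundamentalLatticeRep 2).N × Bool → ℝ := fun q'' => (fun z : ℂ => if q''.2.2.2 then z.im else z.re)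
    (Q q''.1 q''.2.1 q''.2.2.1) with hy₀
  set σ : (Edge d L × Fin (fundamentalLatticeRep 2).N × Fin (fundamentalLatticeRep 2).N × Bool) → (Edge d L × NoiseIdx (fundamentalLatticeRep 2).N) → ℝ := fun q' n =>
    if n.1 = q'.1 then (fun z : ℂ => if q'.2.2.2 then z.im else z.re)
      ((latticeLangevinDynamics (fundamentalLatticeRep 2) β).noise Q q'.1 n.2 q'.2.1 q'.2.2.1) else 0 with hσ
  set P : NoiseIdx (fundamentalLatticeRep 2).N → Matrix (Fin (fundamentalLatticeRep 2).N) (Fin (fundamentalLatticeRep 2).N) ℂ := fun n₂ => (fundamentalLatticeRep 2).lieProj (noiseDir n₂) with hP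
  set S : NoiseIdx (fundamentalLatticeRep 2).N → ℝ := fun n₂ => ∑ j ∈ univ.erase q.1.2, ∑ b : Bool, (P n₂ * rootedLoop Q q.1 j b).trace.re with hS
  -- Step 1: reorganise the right-hand side as `½ Σ_n σ_{q n} · Dψ̂(y₀)[Σ_{q'} σ_{q' n} e_{q'}]`
  have hstep1 : (1 / 2 : ℝ) * ∑ q' : Edge d L × Fin (fundamentalLatticeRep 2).N × Fin (fundamentalLatticeRep 2).N × Bool, (∑ n : Edge d L × NoiseIdx (fundamentalLatticeRep 2).N, σ q n * σ q' n) *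
      fderiv ℝ ψh y₀ (Pi.single q' 1) =
      1 / 2 * ∑ n : Edge d L × NoiseIdx (fundamentalLatticeRep 2).N, σ q n * fderiv ℝ ψh y₀ (∑ q' : Edge d L × Fin (fundamentalLatticeRep 2).N × Fin (fundamentalLatticeRep 2).N × Bool,
        σ q' n • (Pi.single q' (1 : ℝ) : Edge d L × Fin (fundamentalLatticeRep 2).N × Fin (fundamentalLatticeRep 2).N × Bool → ℝ)) := by
    congr 1
    simp_rw [map_sum, map_smul, smul_eq_mul, Finset.sum_mul, Finset.mul_sum]
    rw [Finset.sum_comm]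
    exact Finset.sum_congr rfl fun n _ => Finset.sum_congr rfl fun q' _ => by ring
  -- Step 2: the direction is the coordinate vector of the noise field, and `Dψ̂` along it is the plaquette derivative
  have hstep2 : ∀ n : Edge d L × NoiseIdx (fundamentalLatticeRep 2).N, fderiv ℝ ψh y₀ (∑ q' : Edge d L × Fin (fundamentalLatticeRep 2).N × Fin (fundamentalLatticeRep 2).N × Bool,
        σ q' n • (Pi.single q' (1 : ℝ) : Edge d L × Fin (fundamentalLatticeRep 2).N × Fin (fundamentalLatticeRep 2).N × Bool → ℝ)) =
      β * ∑ j ∈ univ.erase n.1.2, ∑ b : Bool, (((Real.sqrt 2 : ℂ) • P n.2) * rootedLoop Q n.1 j b).trace.re := by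
    intro n
    obtain ⟨hnoise, hskew⟩ := noise_eq_mul β Q n.1 n.2
    rw [hσ, sum_noiseCoord_smul_single β Q n, hnoise, hψh, hy₀]
    exact fderiv_psiHat_flat_single β Q n.1 hskew
  -- Step 3: traces and entries of the `√2`-multiples
  have hsqrt : Real.sqrt 2 * Real.sqrt 2 = 2 := Real.mul_self_sqrt (by norm_num)
  have htrace : ∀ (n₂ : NoiseIdx (fundamentalLatticeRep 2).N) (M : Matrix (Fin (fundamentalLatticeRep 2).N) (Fin (fundamentalLatticeRep 2).N) ℂ),
      (((Real.sqrt 2 : ℂ) • P n₂) * M).trace.re = Real.sqrt 2 * (P n₂ * M).trace.re := by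
    intro n₂ M
    rw [Matrix.smul_mul, Matrix.trace_smul, smul_eq_mul, Complex.re_ofReal_mul]
  have hσq : ∀ n : Edge d L × NoiseIdx (fundamentalLatticeRep 2).N, n.1 = q.1 →
      σ q n = Real.sqrt 2 * (fun z : ℂ => if q.2.2.2 then z.im else z.re) ((P n.2 * Q q.1) q.2.1 q.2.2.1) := by
    intro n hn
    have hentry : (latticeLangevinDynamics (fundamentalLatticeRep 2) β).noise Q q.1 n.2 q.2.1 q.2.2.1 =
        (Real.sqrt 2 : ℂ) * (P n.2 * Q q.1) q.2.1 q.2.2.1 := by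
      have h1 := (noise_eq_mul β Q q.1 n.2).1
      rw [Matrix.smul_mul] at h1
      have h2 := congrFun (congrFun h1 q.2.1) q.2.2.1
      rw [Matrix.smul_apply, smul_eq_mul] at h2
      exact h2
    rw [hσ]
    simp only [if_pos hn]
    rw [hentry]
    exact ite_im_re_ofReal_mul q.2.2.2 (Real.sqrt 2) _
  -- Step 4: the left-hand side through the frame expansion of the drift
  have hLHS : (fun z : ℂ => if q.2.2.2 then z.im else z.re)
      (((fundamentalLatticeRep 2).driftLie β Q q.1 * Q q.1) q.2.1 q.2.2.1) =
      ∑ n₂ : NoiseIdx (fundamentalLatticeRep 2).N, (β * S n₂) * (fun z : ℂ => if q.2.2.2 then z.im else z.re) ((P n₂ * Q q.1) q.2.1 q.2.2.1) := by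
    rw [driftLie_eq_sum_lieProj_noiseDir (fundamentalLatticeRep 2) β Q q.1, Finset.sum_mul, Matrix.sum_apply, reIm_sum]
    refine Finset.sum_congr rfl fun n₂ _ => ?_
    rw [Matrix.smul_mul, Matrix.smul_apply, Complex.real_smul, reIm_ofReal_mul]
  -- assemble
  change (fun z : ℂ => if q.2.2.2 then z.im else z.re)
      (((fundamentalLatticeRep 2).driftLie β Q q.1 * Q q.1) q.2.1 q.2.2.1) =
    (1 / 2 : ℝ) * ∑ q' : Edge d L × Fin (fundamentalLatticeRep 2).N × Fin (fundamentalLatticeRep 2).N × Bool, (∑ n : Edge d L × NoiseIdx (fundamentalLatticeRep 2).N, σ q n * σ q' n) *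
      fderiv ℝ ψh y₀ (Pi.single q' 1)
  rw [hstep1, hLHS]
  simp_rw [hstep2]
  -- only the noise fields of the link `q.1` contribute
  have hvanish : ∀ e' : Edge d L, e' ≠ q.1 → ∀ n₂ : NoiseIdx (fundamentalLatticeRep 2).N, σ q (e', n₂) = 0 := by
    intro e' he' n₂; rw [hσ]; simp only [if_neg he']
  have hRHS : (1 / 2 : ℝ) * ∑ n : Edge d L × NoiseIdx (fundamentalLatticeRep 2).N, σ q n * (β * ∑ j ∈ univ.erase n.1.2, ∑ b : Bool,
      (((Real.sqrt 2 : ℂ) • P n.2) * rootedLoop Q n.1 j b).trace.re) =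
      ∑ n₂ : NoiseIdx (fundamentalLatticeRep 2).N, (1 / 2 : ℝ) * (σ q (q.1, n₂) * (β * ∑ j ∈ univ.erase q.1.2, ∑ b : Bool,
        (((Real.sqrt 2 : ℂ) • P n₂) * rootedLoop Q q.1 j b).trace.re)) := by
    rw [Finset.mul_sum, Fintype.sum_prod_type]
    rw [Finset.sum_eq_single (q.1 : Edge d L) (fun e' _ he' => by
      simp only [hvanish e' he', zero_mul, mul_zero, Finset.sum_const_zero]) (fun h => absurd (Finset.mem_univ _) h)]
  rw [hRHS]
  refine Finset.sum_congr rfl fun n₂ _ => ?_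
  rw [hσq (q.1, n₂) rfl]
  simp only [hS, htrace, Finset.mul_sum, Finset.sum_mul]
  refine Finset.sum_congr rfl fun j _ => Finset.sum_congr rfl fun b _ => ?_
  linear_combination (-(1 / 2) * β * (P n₂ * rootedLoop Q q.1 j b).trace.re *
    ((fun z : ℂ => if q.2.2.2 then z.im else z.re) ((P n₂ * Q q.1) q.2.1 q.2.2.1))) * hsqrt

end Summit.QuantumFields.YangMills.Theorems.ColdStartUniversality

end
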